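import Mathlib.NumberTheory.Cyclotomic.Gal
import Mathlib.NumberTheory.Cyclotomic.PrimitiveRoots
import Mathlib.NumberTheory.Padics.Complex
import Mathlib.NumberTheory.DirichletCharacter.Basic
import Mathlib.RingTheory.Polynomial.Cyclotomic.Roots
import Mathlib.Algebra.Polynomial.SpecificDegree
import Mathlib.GroupTheory.SpecificGroups.Cyclic
import Mathlib.FieldTheory.IsAlgClosed.Basic
import Summits.BirchSwinnertonDyer.BirchSwinnertonDyer.Theorems.CyclotomicUntwistFiniteSlopeLineHeightVacuity
import Summits.BirchSwinnertonDyer.BirchSwinnertonDyer.Theorems.CyclotomicUntwistCoefficientField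
import Summits.BirchSwinnertonDyer.BirchSwinnertonDyer.Theorems.CyclotomicUntwistLineHeightRigidity
import HarnessLib

/-!
# Route `CyclotomicUntwist`: the COEFFICIENT PACKAGE of the `ψ`-line — over `R = ℚ₃(ζ₃)` an
# order-`3` character `ψ` mod `9` (the line), its conjugation `σ` (`ψ ∘ σ = ψ⁻¹`, cycu-p1 g2), and an
# embedding `ι : ℚ₃(ζ₃) ↪ ℂ₃` — packaged in the closers' binder shape (route-free kernel theorems)

Cell `pub/bsd-wall` (D-0145 line `route-BirchSwinnertonDyer-CyclotomicUntwist`), width seat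
`bsd-line-cycu-p5` g0. THEOREMS ONLY (no definition, no named fact, no `sorry`); helper `--supports`
K1 = stmt-BirchSwinnertonDyer-21580. BSD is not proved by this file; nothing here bears on the truth
of K1/K2.

Every composition of the finite-slope road landed so far (`CyclotomicUntwistFiniteSlopeShadowTyped`,
`…KatoTyped`, `…WanTyped`, and the separated closer in flight) quantifies, per row, over COEFFICIENT
DATA of the `ψ`-line: a commutative `ℚ₃`-algebra `R`, a Dirichlet character `ψ` mod `9` of exact
order `3` with values in `R` (the LINE), an automorphism `σ ∈ Aut(R/ℚ₃)` with `ψ.ringHomComp σ = ψ⁻¹`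
(the conjugation exchanging the two lines) and an injective `ι : R →ₐ[ℚ₃] ℂ₃` (to read `R`-valued
heights in `ℂ₃`). This data is independent of the curve; this file EXHIBITS it:

* §2 over `K := CyclotomicField 3 ℚ_[3]` (`= ℚ₃(ζ₃)`, `ζ := zeta 3 ℚ₃ K`): the LINE itself — a
  Dirichlet character `ψ` mod `9` with `ψ(2) = ζ` (the unit group `(ℤ/9)^×` is generated by `2`, of
  order `6`; Mathlib `monoidHomOfForallMemZpowers`), hence `ψ³ = 1`, `ψ ≠ 1`; combined with
  cycu-p1 g2's conjugation (`PSCoefficientField.exists_algEquiv_ringHomComp_eq_inv`, which gives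
  `σ` with `ψ.ringHomComp σ = ψ⁻¹` for every `ψ` with `ψ³ = 1` — that file proves
  `Irreducible (cyclotomic 3 ℚ₃)`; nothing of it is restated here) and an embedding `ι : K →ₐ[ℚ₃] ℂ₃`
  (`IsAlgClosed.lift`; injective as `K` is a field).
* §3 `exists_lineCoefficientPackage` — the package in the closers' binder shape
  `∃ (R : Type) (_ : CommRing R) (_ : Algebra ℚ_[3] R) (ψ σ ι), …`; and, with part II of the
  vacuity census (`CyclotomicUntwistFiniteSlopeLineHeightVacuity`), the COMPLETE certificate that
  the dichotomy child C4 of the withdrawn K1 split spec is inhabited by construction on every curve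
  with a point of infinite order / of analytic rank one granted GZK
  (`exists_closerLineData_of_not_isOfFinAddOrder`, `…_of_analyticRank_eq_one`).

References: Washington, *Cyclotomic Fields*, Thm. 2.5 (Galois group of a cyclotomic extension);
Benois 2020 §0.3 (the intended `R = ℚ₃(ζ₃)` of D2 `PSLineHeightData`). [cite: Washington1997, Thm. 2.5]
[cite: Benois2020, §0.3]
-/

set_option autoImplicit false
-- single-conjunct summit: `Summit.BirchSwinnertonDyer.BirchSwinnertonDyer.…` repeats the name by design
set_option linter.dupNamespace false

noncomputable section

open scoped Classical

open Polynomial IsCyclotomicExtension WeierstrassCurve Literature.NumberTheory.EllipticCurves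

namespace Summit.BirchSwinnertonDyer.BirchSwinnertonDyer.Theorems.PSLineCoefficients

/-! ### §2 `K = ℚ₃(ζ₃)`: the order-`3` character mod `9` (the line), the conjugation, the embedding -/

section K

/-- The unit `2 ∈ (ℤ/9)^×` has order `6 = φ(9)`, so it generates the unit group. [folklore] -/
theorem forall_mem_zpowers_two_zmod_nine :
    ∀ x : (ZMod 9)ˣ, x ∈ Subgroup.zpowers (ZMod.unitOfCoprime 2 (by decide) : (ZMod 9)ˣ) := by
  have hord : orderOf (ZMod.unitOfCoprime 2 (by decide) : (ZMod 9)ˣ) = 6 := by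
    rw [orderOf_eq_iff (by norm_num)]
    refine ⟨by decide, fun m hm hm0 ↦ ?_⟩
    interval_cases m <;> decide
  have hcard : Nat.card (ZMod 9)ˣ = 6 := by
    rw [Nat.card_eq_fintype_card, ZMod.card_units_eq_totient]; decide
  have htop : Subgroup.zpowers (ZMod.unitOfCoprime 2 (by decide) : (ZMod 9)ˣ) = ⊤ :=
    Subgroup.eq_top_of_card_eq _ (by rw [Nat.card_zpowers, hord, hcard])
  intro x
  rw [htop]
  exact Subgroup.mem_top x

/-- **The line over `ℚ₃(ζ₃)`: an order-`3` Dirichlet character mod `9`.** There is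
`ψ : DirichletCharacter ℚ₃(ζ₃) 9` with `ψ(2) = ζ₃`, hence `ψ³ = 1` and `ψ ≠ 1` (the two such
characters are `ψ` and `ψ̄ = ψ²`; they are the LINES of D2 `PSLineHeightData`). Construction: the
homomorphism `(ℤ/9)^× = ⟨2⟩ → ℚ₃(ζ₃)^×`, `2 ↦ ζ₃` (`monoidHomOfForallMemZpowers`), as a `MulChar`.
[cite: Benois2020, §0.3] [cite: Washington1997, Thm. 2.5] -/
theorem exists_line_nine :
    ∃ ψ : DirichletCharacter (CyclotomicField 3 ℚ_[3]) 9,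
      ψ (2 : ZMod 9) = zeta 3 ℚ_[3] (CyclotomicField 3 ℚ_[3]) ∧ ψ ^ 3 = 1 ∧ ψ ≠ 1 := by
  set K := CyclotomicField 3 ℚ_[3] with hK
  have hζ := zeta_spec 3 ℚ_[3] K
  set ζ : K := zeta 3 ℚ_[3] K with hζdef
  -- the unit `ζ` and the generator `2` of `(ℤ/9)^×`
  set ζu : Kˣ := hζ.toRootsOfUnity.val with hζu
  have hζu_coe : (ζu : K) = ζ := by simp [hζu]
  set g : (ZMod 9)ˣ := ZMod.unitOfCoprime 2 (by decide) with hg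
  have hgen := forall_mem_zpowers_two_zmod_nine
  have hζu3 : ζu ^ 3 = 1 := by ext; simp [hζu_coe, hζ.pow_eq_one]
  have hdvd : orderOf ζu ∣ orderOf g := by
    have h1 : orderOf ζu ∣ 3 := orderOf_dvd_of_pow_eq_one hζu3
    have hord : orderOf g = 6 := by
      rw [orderOf_eq_iff (by norm_num)]
      refine ⟨by decide, fun m hm hm0 ↦ ?_⟩
      interval_cases m <;> decide
    rw [hord]
    exact h1.trans (by norm_num)
  set f : (ZMod 9)ˣ →* Kˣ := monoidHomOfForallMemZpowers hgen hdvd with hf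
  have hfg : f g = ζu := monoidHomOfForallMemZpowers_apply_gen hgen hdvd
  set ψ : DirichletCharacter K 9 := MulChar.ofUnitHom f with hψ
  -- values on units: `ψ (g^k) = ζ^k`
  have hψ_unit : ∀ a : (ZMod 9)ˣ, ∃ k : ℤ, a = g ^ k ∧ ψ (a : ZMod 9) = ((ζu ^ k : Kˣ) : K) := by
    intro a
    obtain ⟨k, hk⟩ := Subgroup.mem_zpowers_iff.mp (hgen a)
    refine ⟨k, hk.symm, ?_⟩
    rw [hψ, MulChar.ofUnitHom_coe, ← hk, map_zpow, hfg]
  have hψ2 : ψ (2 : ZMod 9) = ζ := by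
    have h2 : ((g : (ZMod 9)ˣ) : ZMod 9) = 2 := rfl
    rw [← h2, hψ, MulChar.ofUnitHom_coe, hfg, hζu_coe]
  refine ⟨ψ, hψ2, ?_, ?_⟩
  · -- `ψ³ = 1`
    refine MulChar.ext fun a ↦ ?_
    obtain ⟨k, rfl, hk⟩ := hψ_unit a
    rw [MulChar.pow_apply_coe, hk, MulChar.one_apply_coe, ← Units.val_pow_eq_pow_val, ← zpow_natCast,
      ← zpow_mul, mul_comm, zpow_mul, zpow_natCast, hζu3, one_zpow, Units.val_one]
  · -- `ψ ≠ 1`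
    intro h1
    have h := congrArg (fun χ : DirichletCharacter K 9 ↦ χ (2 : ZMod 9)) h1
    simp only [hψ2] at h
    have h2u : IsUnit (2 : ZMod 9) := ⟨g, rfl⟩
    rw [MulChar.one_apply h2u] at h
    exact hζ.ne_one (by norm_num) h

/-- **The line and its conjugation together**: `ψ` mod `9` over `ℚ₃(ζ₃)` with `ψ³ = 1`, `ψ ≠ 1`, and
`σ ∈ Aut(ℚ₃(ζ₃)/ℚ₃)` with `ψ.ringHomComp σ = ψ⁻¹` — the `σ` is cycu-p1 g2's
`PSCoefficientField.exists_algEquiv_ringHomComp_eq_inv` (imported, not restated).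
[cite: Benois2020, §0.3] [cite: Washington1997, Thm. 2.5] -/
theorem exists_line_and_conjugation :
    ∃ (ψ : DirichletCharacter (CyclotomicField 3 ℚ_[3]) 9)
      (σ : CyclotomicField 3 ℚ_[3] ≃ₐ[ℚ_[3]] CyclotomicField 3 ℚ_[3]),
      ψ (2 : ZMod 9) = zeta 3 ℚ_[3] (CyclotomicField 3 ℚ_[3]) ∧ ψ ^ 3 = 1 ∧ ψ ≠ 1 ∧
      ψ.ringHomComp (σ : CyclotomicField 3 ℚ_[3] →+* CyclotomicField 3 ℚ_[3]) = ψ⁻¹ := by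
  obtain ⟨ψ, h2, h3, h1⟩ := exists_line_nine
  obtain ⟨σ, hσ⟩ := PSCoefficientField.exists_algEquiv_ringHomComp_eq_inv
  exact ⟨ψ, σ, h2, h3, h1, hσ 9 ψ h3⟩

/-- **An embedding `ℚ₃(ζ₃) ↪ ℂ₃` over `ℚ₃`** (`ℂ₃` is algebraically closed and `ℚ₃(ζ₃)/ℚ₃` is
finite; any field homomorphism is injective). [folklore] -/
theorem exists_algHom_padicComplex_injective :
    ∃ ι : CyclotomicField 3 ℚ_[3] →ₐ[ℚ_[3]] ℂ_[3], Function.Injective ι := by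
  haveI : Module.Finite ℚ_[3] (CyclotomicField 3 ℚ_[3]) :=
    IsCyclotomicExtension.finite {3} ℚ_[3] (CyclotomicField 3 ℚ_[3])
  exact ⟨IsAlgClosed.lift, (IsAlgClosed.lift : CyclotomicField 3 ℚ_[3] →ₐ[ℚ_[3]] ℂ_[3]).injective⟩

end K

/-! ### §3 The package in the closers' binder shape; C4 inhabited, complete certificate -/

/-- **The coefficient package of the `ψ`-line exists**: a commutative non-trivial `ℚ₃`-algebra `R`
(namely `ℚ₃(ζ₃)`), a line `ψ` mod `9` (`ψ³ = 1`, `ψ ≠ 1`), `σ ∈ Aut(R/ℚ₃)` with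
`ψ.ringHomComp σ = ψ⁻¹`, and an injective `ι : R →ₐ[ℚ₃] ℂ₃` — exactly the curve-independent binders
`(R, ψ, σ, ι)` of the route's finite-slope closers. [cite: Benois2020, §0.3] [cite: Washington1997, Thm. 2.5] -/
theorem exists_lineCoefficientPackage :
    ∃ (R : Type) (_ : CommRing R) (_ : Algebra ℚ_[3] R) (ψ : DirichletCharacter R 9)
      (σ : R ≃ₐ[ℚ_[3]] R) (ι : R →ₐ[ℚ_[3]] ℂ_[3]),
      Nontrivial R ∧ ψ ^ 3 = 1 ∧ ψ ≠ 1 ∧ ψ.ringHomComp (σ : R →+* R) = ψ⁻¹ ∧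
        Function.Injective ι := by
  obtain ⟨ψ, σ, -, h3, h1, hσ⟩ := exists_line_and_conjugation
  obtain ⟨ι, hι⟩ := exists_algHom_padicComplex_injective
  exact ⟨CyclotomicField 3 ℚ_[3], inferInstance, inferInstance, ψ, σ, ι, inferInstance, h3, h1, hσ, hι⟩

/-- **C4 of the withdrawn K1 split spec, complete certificate (point form).** For every elliptic
`W/ℚ` and every `P ∈ E(ℚ)` of infinite order there are coefficient data `(R, ψ, σ, ι)` as in the
closers AND a line-height datum `Dh : W.PSLineHeightData R` with the dichotomy
`h_ψ(P,P) ≠ 0 ∨ h_ψ̄(P,P) ≠ 0` — the package of §3 with the datum of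
`CyclotomicUntwistFiniteSlopeLineHeightVacuity.exists_lineHeightData_dichotomy`. Nothing about
Benois's height is used or obtained. [cite: Benois2020, §0.3 (Thm. II–III)] [cite: SilvermanAEC2009, Thm. VIII.6.7] -/
theorem exists_closerLineData_of_not_isOfFinAddOrder (W : WeierstrassCurve ℚ) [W.IsElliptic]
    (P : W.toAffine.Point) (hP : ¬ IsOfFinAddOrder P) :
    ∃ (R : Type) (_ : CommRing R) (_ : Algebra ℚ_[3] R) (Dh : W.PSLineHeightData R)
      (ψ : DirichletCharacter R 9) (σ : R ≃ₐ[ℚ_[3]] R) (ι : R →ₐ[ℚ_[3]] ℂ_[3]),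
      ψ.ringHomComp (σ : R →+* R) = ψ⁻¹ ∧ Function.Injective ι ∧
        (Dh.pairing ψ P P ≠ 0 ∨ Dh.pairing ψ⁻¹ P P ≠ 0) := by
  obtain ⟨R, _, _, ψ, σ, ι, hnt, h3, h1, hσ, hι⟩ := exists_lineCoefficientPackage
  obtain ⟨Dh, hDh⟩ :=
    CyclotomicUntwistFiniteSlopeLineHeightVacuity.exists_lineHeightData_dichotomy W R ψ ⟨h3, h1⟩ P hP
  exact ⟨R, inferInstance, inferInstance, Dh, ψ, σ, ι, hσ, hι, hDh⟩

/-- **C4 complete certificate on the rows**: granted Gross–Zagier–Kolyvagin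
(`rank_eq_analyticRank_of_analyticRank_le_one` = the route's `PublishedInputGZK`), every elliptic
`W/ℚ` of analytic rank one carries coefficient data `(R, ψ, σ, ι)` as in the closers, a point `P` and
a datum `Dh` with `h_ψ(P,P) ≠ 0 ∨ h_ψ̄(P,P) ≠ 0`. So the child
`∀ row, ∃ (R, Dh, ψ, σ, ι injective, σ∘ψ = ψ⁻¹, P), DICHOTOMY₃` is closed by bookkeeping.
[cite: Benois2020, §0.3 (Thm. II–III)] [cite: Darmon2004, Thm. 3.22] -/
theorem exists_closerLineData_of_analyticRank_eq_one
    (hGZK : rank_eq_analyticRank_of_analyticRank_le_one) (W : WeierstrassCurve ℚ) [W.IsElliptic]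
    (hr : W.analyticRank = 1) :
    ∃ (R : Type) (_ : CommRing R) (_ : Algebra ℚ_[3] R) (Dh : W.PSLineHeightData R)
      (ψ : DirichletCharacter R 9) (σ : R ≃ₐ[ℚ_[3]] R) (ι : R →ₐ[ℚ_[3]] ℂ_[3]) (P : W.toAffine.Point),
      ψ.ringHomComp (σ : R →+* R) = ψ⁻¹ ∧ Function.Injective ι ∧
        (Dh.pairing ψ P P ≠ 0 ∨ Dh.pairing ψ⁻¹ P P ≠ 0) := by
  obtain ⟨R, _, _, ψ, σ, ι, hnt, h3, h1, hσ, hι⟩ := exists_lineCoefficientPackage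
  obtain ⟨Dh, P, hDh⟩ :=
    CyclotomicUntwistFiniteSlopeLineHeightVacuity.exists_lineHeightData_dichotomy_of_analyticRank_eq_one
      hGZK W hr R ψ ⟨h3, h1⟩
  exact ⟨R, inferInstance, inferInstance, Dh, ψ, σ, ι, P, hσ, hι, hDh⟩

/-! ### §4 (appended) The LINE ORBIT over `ℚ₃(ζ₃)`: every line mod `9` is `ψ` or `ψ ∘ σ`;
### hence on a rank-one curve a line-height datum over `ℚ₃(ζ₃)` is ONE element of `ℚ₃(ζ₃)` -/

section Orbit

/-- **A Dirichlet character mod `9` is determined by its value at `2`** (the unit group `(ℤ/9)^×`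
is generated by `2`): valued in any commutative ring. [folklore] -/
theorem eq_of_apply_two_eq {R : Type*} [CommRing R] (χ χ' : DirichletCharacter R 9)
    (h : χ (2 : ZMod 9) = χ' (2 : ZMod 9)) : χ = χ' := by
  set g : (ZMod 9)ˣ := ZMod.unitOfCoprime 2 (by decide) with hg
  have hgen := forall_mem_zpowers_two_zmod_nine
  have hug : MulChar.toUnitHom χ g = MulChar.toUnitHom χ' g := by
    ext
    rw [MulChar.coe_toUnitHom, MulChar.coe_toUnitHom]
    exact h
  refine MulChar.ext fun a ↦ ?_
  obtain ⟨k, hk⟩ := Subgroup.mem_zpowers_iff.mp (hgen a)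
  rw [← hk, ← MulChar.coe_toUnitHom, ← MulChar.coe_toUnitHom, map_zpow, map_zpow, hug]

/-- **Over `ℚ₃(ζ₃)` every character mod `9` of order dividing `3` is a power of the line `ψ` with
`ψ(2) = ζ₃`**: `χ³ = 1 ⇒ χ = ψ^i` for some `i < 3` (`χ(2)` is a cube root of unity of the FIELD
`ℚ₃(ζ₃)`, hence `ζ₃^i`, and a character mod `9` is determined by its value at `2`).
[cite: Washington1997, Thm. 2.5] -/
theorem eq_pow_of_pow_three_eq_one (ψ : DirichletCharacter (CyclotomicField 3 ℚ_[3]) 9)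
    (hψ2 : ψ (2 : ZMod 9) = zeta 3 ℚ_[3] (CyclotomicField 3 ℚ_[3]))
    (χ : DirichletCharacter (CyclotomicField 3 ℚ_[3]) 9) (hχ : χ ^ 3 = 1) :
    ∃ i < 3, χ = ψ ^ i := by
  have hζ := zeta_spec 3 ℚ_[3] (CyclotomicField 3 ℚ_[3])
  have h2u : IsUnit (2 : ZMod 9) := ⟨ZMod.unitOfCoprime 2 (by decide), rfl⟩
  obtain ⟨u, hu⟩ := h2u
  have hχ2 : (χ (2 : ZMod 9)) ^ 3 = 1 := by
    rw [← hu, ← MulChar.pow_apply_coe, hχ, MulChar.one_apply_coe]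
  obtain ⟨i, hi, hζi⟩ := hζ.eq_pow_of_pow_eq_one hχ2
  refine ⟨i, hi, eq_of_apply_two_eq χ (ψ ^ i) ?_⟩
  rw [← hζi, ← hu, MulChar.pow_apply_coe, hu, hψ2]

/-- **The lines over `ℚ₃(ζ₃)` are exactly `ψ` and `ψ²`** (for the `ψ` with `ψ(2) = ζ₃`).
[cite: Washington1997, Thm. 2.5] -/
theorem isLine_iff_eq_or_eq_sq (ψ : DirichletCharacter (CyclotomicField 3 ℚ_[3]) 9)
    (hψ2 : ψ (2 : ZMod 9) = zeta 3 ℚ_[3] (CyclotomicField 3 ℚ_[3]))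
    (χ : DirichletCharacter (CyclotomicField 3 ℚ_[3]) 9) :
    (χ ^ 3 = 1 ∧ χ ≠ 1) ↔ (χ = ψ ∨ χ = ψ ^ 2) := by
  have hζ := zeta_spec 3 ℚ_[3] (CyclotomicField 3 ℚ_[3])
  have h2u : IsUnit (2 : ZMod 9) := ⟨ZMod.unitOfCoprime 2 (by decide), rfl⟩
  -- `ψ³ = 1` and `ψ ≠ 1`, `ψ² ≠ 1` from the values at `2`
  have hψ3 : ψ ^ 3 = 1 := by
    refine eq_of_apply_two_eq _ _ ?_
    obtain ⟨u, hu⟩ := h2u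
    rw [← hu, MulChar.pow_apply_coe, MulChar.one_apply_coe, hu, hψ2, hζ.pow_eq_one]
  have hne : ∀ i, 0 < i → i < 3 → ψ ^ i ≠ 1 := by
    intro i hi0 hi3 h1
    have h : (ψ ^ i) (2 : ZMod 9) = (1 : DirichletCharacter (CyclotomicField 3 ℚ_[3]) 9) (2 : ZMod 9) := by
      rw [h1]
    obtain ⟨u, hu⟩ := h2u
    rw [← hu, MulChar.pow_apply_coe, MulChar.one_apply_coe, hu, hψ2] at h
    exact hζ.pow_ne_one_of_pos_of_lt hi0.ne' hi3 h
  constructor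
  · rintro ⟨h3, h1⟩
    obtain ⟨i, hi, rfl⟩ := eq_pow_of_pow_three_eq_one ψ hψ2 χ h3
    interval_cases i
    · exact absurd (pow_zero ψ) h1
    · exact Or.inl (pow_one ψ)
    · exact Or.inr rfl
  · rintro (rfl | rfl)
    · exact ⟨hψ3, by simpa using hne 1 one_pos (by norm_num)⟩
    · refine ⟨by rw [← pow_mul, show 2 * 3 = 3 * 2 by norm_num, pow_mul, hψ3, one_pow],
        hne 2 two_pos (by norm_num)⟩

/-- **The line orbit over `ℚ₃(ζ₃)`**: for every line `ψ` (`ψ³ = 1`, `ψ ≠ 1`) and every line `χ`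
there is `σ ∈ Aut(ℚ₃(ζ₃)/ℚ₃)` with `χ = ψ.ringHomComp σ` — the hypothesis `horbit` of cycu-p4 g0's
rank-one rigidity `CyclotomicUntwistLineHeightRigidity.eq_of_rank_one_of_line_orbit`, DISCHARGED for
the intended coefficient ring. (`χ ∈ {ψ, ψ²}` by `isLine_iff_eq_or_eq_sq`; `ψ² = ψ⁻¹ = ψ ∘ σ` by
cycu-p1 g2's `PSCoefficientField.exists_algEquiv_ringHomComp_eq_inv`.) [cite: Washington1997, Thm. 2.5] [cite: Benois2020, §0.3] -/
theorem exists_ringHomComp_eq_of_isLine (ψ χ : DirichletCharacter (CyclotomicField 3 ℚ_[3]) 9)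
    (hψ : ψ ^ 3 = 1 ∧ ψ ≠ 1) (hχ : χ ^ 3 = 1 ∧ χ ≠ 1) :
    ∃ σ : CyclotomicField 3 ℚ_[3] ≃ₐ[ℚ_[3]] CyclotomicField 3 ℚ_[3],
      χ = ψ.ringHomComp (σ : CyclotomicField 3 ℚ_[3] →+* CyclotomicField 3 ℚ_[3]) := by
  obtain ⟨ψ₀, hψ₀2, -, -⟩ := exists_line_nine
  obtain ⟨σ, hσ⟩ := PSCoefficientField.exists_algEquiv_ringHomComp_eq_inv
  -- identity case helper: `χ.ringHomComp id = χ`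
  have hid : ∀ φ : DirichletCharacter (CyclotomicField 3 ℚ_[3]) 9,
      φ.ringHomComp ((AlgEquiv.refl : CyclotomicField 3 ℚ_[3] ≃ₐ[ℚ_[3]] CyclotomicField 3 ℚ_[3]) :
        CyclotomicField 3 ℚ_[3] →+* CyclotomicField 3 ℚ_[3]) = φ := by
    intro φ; ext a; rfl
  -- `ψ² = ψ ∘ σ`
  have hsq : ψ ^ 2 = ψ.ringHomComp (σ : CyclotomicField 3 ℚ_[3] →+* CyclotomicField 3 ℚ_[3]) := by
    rw [hσ 9 ψ hψ.1]
    refine eq_inv_of_mul_eq_one_left ?_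
    rw [← pow_succ, hψ.1]
  rcases (isLine_iff_eq_or_eq_sq ψ₀ hψ₀2 ψ).mp hψ with hψe | hψe <;>
    rcases (isLine_iff_eq_or_eq_sq ψ₀ hψ₀2 χ).mp hχ with hχe | hχe
  · exact ⟨AlgEquiv.refl, by rw [hid, hχe, hψe]⟩
  · exact ⟨σ, by rw [← hsq, hχe, hψe]⟩
  · refine ⟨σ, ?_⟩
    rw [← hsq, hχe, hψe, ← pow_mul]
    -- `ψ₀ = ψ₀⁴` since `ψ₀³ = 1`
    have h3 : ψ₀ ^ 3 = 1 := ((isLine_iff_eq_or_eq_sq ψ₀ hψ₀2 ψ₀).mpr (Or.inl rfl)).1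
    rw [show 2 * 2 = 3 + 1 by norm_num, pow_add, h3, one_mul, pow_one]
  · exact ⟨AlgEquiv.refl, by rw [hid, hχe, hψe]⟩

/-- **One number per `(W, ψ)` over `ℚ₃(ζ₃)`, unconditionally in the coefficients**: on a curve of
Mordell–Weil rank one, for any point `g` of infinite order and any line `ψ` over `ℚ₃(ζ₃)`, the map
`Dh ↦ h_ψ(g,g)` is INJECTIVE on line-height data `Dh : W.PSLineHeightData (ℚ₃(ζ₃))` (cycu-p4 g0's
`pairing_self_injective_of_line_orbit` with its orbit hypothesis discharged by
`exists_ringHomComp_eq_of_isLine`). This is the precise sense in which a canonicity predicate (D5)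
has to pin exactly ONE element of `ℚ₃(ζ₃)` per row. [cite: Benois2020, §0.3 (Thm. I–III)] -/
theorem pairing_self_injective_cyclotomic (W : WeierstrassCurve ℚ) (hr1 : W.mordellWeilRank = 1)
    {g : W.toAffine.Point} (hg : ¬ IsOfFinAddOrder g)
    (ψ : DirichletCharacter (CyclotomicField 3 ℚ_[3]) 9) (hψ : ψ ^ 3 = 1 ∧ ψ ≠ 1) :
    Function.Injective
      fun Dh : W.PSLineHeightData (CyclotomicField 3 ℚ_[3]) ↦ Dh.pairing ψ g g :=
  CyclotomicUntwistLineHeightRigidity.pairing_self_injective_of_line_orbit hr1 hg ψ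
    fun χ h3 h1 ↦ exists_ringHomComp_eq_of_isLine ψ χ hψ ⟨h3, h1⟩

end Orbit

end Summit.BirchSwinnertonDyer.BirchSwinnertonDyer.Theorems.PSLineCoefficients

end
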